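import Summits.CriticalPhenomena.SAWScalingLimit.Theorems.SAWDefectDecoherenceObservableToSLERCarvedDictionary
import HarnessLib

/-!
# Crux `SAWDevelopingMap.ObservableToSLE` (stmt-CriticalPhenomena-10472), line `six-class-type-ladder`,
stub T2b `stub_carvedReduction` (= twin stub 5a4 of stmt-CriticalPhenomena-14005): piece (G6c),
NO BAD EDGE INSIDE A GEOMETRICALLY INNER VERTEX SET

Landing target:
`Summits/CriticalPhenomena/SAWScalingLimit/Theorems/SAWDevelopingMapObservableToSLETypeLadderCarvedReductionCell.lean`
(`--supports stmt-CriticalPhenomena-10472`; registered sub-goal `stub_carvedReduction_cellLink`).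

Clause (c) of the moving-carving squeeze (first hypothesis of the landed
`stub_carvedReduction_assembly`) asks, for the translated pinned family `Λ''`, the cell hypothesis
of the exact sub-domain conditioning: every honeycomb edge between two vertices of `Λ''` is an
edge of the discrete domain `Ω_δ = hexDomainGraph Ω δ` (segment condition AND both ends in the
union of largest components `embMeshDomain`).  This file derives it from GEOMETRY: if the
rescaled centres of `Λ''` lie in `Ω`, the rescaled segments of the honeycomb edges inside `Λ''`
lie in `closure Ω` (e.g. `Λ''` is the lattice shadow of a domain compactly inside `Ω`, mesh small),
`Λ''` is connected in the honeycomb lattice and contains ONE vertex of `Ω_δ` (in the line: the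
gate vertex `q`, read off the realising walk), then all of `Λ''` lies in `Ω_δ`
(`mem_embMeshDomain_of_induce_walk`, closure of the largest component under mesh adjacency,
`embDomainGraph_adj_of_mem_of_adj`) and `Λ''` has no bad edge (`hexDomainGraph_adj_of_geometry`).
-/

noncomputable section

open scoped Topology Classical
open Filter Set Metric
open Literature.Probability.LatticeModels (HexVertex hexGraph hexCenter)
open Literature.Probability.RandomPlanarGeometry
open Literature.Probability.RandomPlanarGeometry.SAW

namespace Summit.CriticalPhenomena.SAWScalingLimit.Theorems.ObservableToSLE.TypeLadder

open Summit.CriticalPhenomena.SAWScalingLimit.Theorems.ObservableToSLER.BridgeGate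

section Geometry

variable {Ω : Set ℂ} {δ : ℝ} {Λ'' : Finset HexVertex}
  (hΩΛ : ∀ w ∈ Λ'', (δ : ℂ) * hexCenter w ∈ Ω)
  (hseg : ∀ w ∈ Λ'', ∀ y ∈ Λ'', hexGraph.Adj w y →
    segment ℝ ((δ : ℂ) * hexCenter w) ((δ : ℂ) * hexCenter y) ⊆ closure Ω)

include hΩΛ hseg

omit hΩΛ in
/-- A honeycomb edge inside `Λ''` is a mesh edge. -/
theorem embMeshGraph_adj_of_geometry {w y : HexVertex} (hw : w ∈ Λ'') (hy : y ∈ Λ'')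
    (hwy : hexGraph.Adj w y) : (embMeshGraph hexGraph hexCenter Ω δ).Adj w y :=
  (embMeshGraph_adj_iff hexGraph hexCenter).2 ⟨hwy, hseg w hw y hy hwy⟩

/-- **Propagation along a walk inside `Λ''`**: the end of a walk of the honeycomb lattice induced
on `Λ''` starting at a vertex of `Ω_δ` is a vertex of `Ω_δ`. -/
theorem mem_embMeshDomain_of_induce_walk {x y : (↑Λ'' : Set HexVertex)}
    (p : (hexGraph.induce (↑Λ'' : Set HexVertex)).Walk x y)
    (hx : (x : HexVertex) ∈ embMeshDomain hexGraph hexCenter Ω δ) :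
    (y : HexVertex) ∈ embMeshDomain hexGraph hexCenter Ω δ := by
  induction p with
  | nil => exact hx
  | @cons a b _ hab _ ih =>
    have hab' : hexGraph.Adj (a : HexVertex) (b : HexVertex) := SimpleGraph.induce_adj.1 hab
    have hmesh := embMeshGraph_adj_of_geometry hseg a.2 b.2 hab'
    have hbV : (b : HexVertex) ∈ embMeshVertices hexCenter Ω δ := hΩΛ _ b.2
    have hadj := embDomainGraph_adj_of_mem_of_adj hx hmesh hbV
    exact ih ((embDomainGraph_adj_iff hexGraph hexCenter).1 hadj).2.2

/-- **All of `Λ''` lies in `Ω_δ`** as soon as `Λ''` is connected in the honeycomb lattice and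
contains one vertex of `Ω_δ`. -/
theorem mem_embMeshDomain_of_geometry (hconn : (hexGraph.induce (↑Λ'' : Set HexVertex)).Preconnected)
    {u : HexVertex} (hu : u ∈ Λ'') (huD : u ∈ embMeshDomain hexGraph hexCenter Ω δ)
    {w : HexVertex} (hw : w ∈ Λ'') : w ∈ embMeshDomain hexGraph hexCenter Ω δ := by
  obtain ⟨p⟩ := hconn ⟨u, Finset.mem_coe.2 hu⟩ ⟨w, Finset.mem_coe.2 hw⟩
  exact mem_embMeshDomain_of_induce_walk hΩΛ hseg p huD

/-- **NO BAD EDGE INSIDE `Λ''`**: under the geometric hypotheses, every honeycomb edge between two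
vertices of `Λ''` is an edge of the discrete domain `Ω_δ`. -/
theorem hexDomainGraph_adj_of_geometry (hconn : (hexGraph.induce (↑Λ'' : Set HexVertex)).Preconnected)
    {u : HexVertex} (hu : u ∈ Λ'') (huD : u ∈ embMeshDomain hexGraph hexCenter Ω δ) :
    ∀ w ∈ Λ'', ∀ y ∈ Λ'', hexGraph.Adj w y → (hexDomainGraph Ω δ).Adj w y := by
  intro w hw y hy hwy
  exact embDomainGraph_adj_of_mem_of_adj (mem_embMeshDomain_of_geometry hΩΛ hseg hconn hu huD hw)
    (embMeshGraph_adj_of_geometry hseg hw hy hwy) (hΩΛ y hy)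

end Geometry

/-- **A vertex read off a walk of `Ω_δ` after its first vertex is a vertex of `Ω_δ`** (it carries
an edge of `Ω_δ`); in the line: the gate vertex `q` of the realising walk from `a δ`. -/
theorem mem_embMeshDomain_of_mem_support_of_ne {Ω : Set ℂ} {δ : ℝ} {a b : HexVertex}
    (π : (hexDomainGraph Ω δ).Walk a b) {q : HexVertex} (hq : q ∈ π.support) (hqa : q ≠ a) :
    q ∈ embMeshDomain hexGraph hexCenter Ω δ := by
  induction π with
  | nil =>
    rw [SimpleGraph.Walk.support_nil, List.mem_singleton] at hq
    exact absurd hq hqa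
  | @cons x y _ hxy p ih =>
    rw [SimpleGraph.Walk.support_cons, List.mem_cons] at hq
    rcases hq with rfl | hq
    · exact absurd rfl hqa
    · by_cases hqy : q = y
      · subst hqy
        exact ((embDomainGraph_adj_iff hexGraph hexCenter).1 hxy).2.2
      · exact ih hq hqy

/-- **Registered sub-goal `stub_carvedReduction_cellLink`** (crux item stmt-CriticalPhenomena-10472,
stub T2b `stub_carvedReduction`, piece (G6c) NO BAD EDGE FROM GEOMETRY): a honeycomb-connected
vertex set whose rescaled centres lie in `Ω`, whose internal honeycomb edges have rescaled segments
in `closure Ω`, and which contains a vertex of a walk of `Ω_δ` other than its initial vertex, has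
no bad edge: all its internal honeycomb edges are edges of `Ω_δ`. -/
theorem stub_carvedReduction_cellLink :
    ∀ (Ω : Set ℂ) (δ : ℝ) (Λ'' : Finset HexVertex) (a b q : HexVertex)
      (π : (hexDomainGraph Ω δ).Walk a b),
      (∀ w ∈ Λ'', (δ : ℂ) * hexCenter w ∈ Ω) →
      (∀ w ∈ Λ'', ∀ y ∈ Λ'', hexGraph.Adj w y →
        segment ℝ ((δ : ℂ) * hexCenter w) ((δ : ℂ) * hexCenter y) ⊆ closure Ω) →
      (hexGraph.induce (↑Λ'' : Set HexVertex)).Preconnected →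
      q ∈ Λ'' → q ∈ π.support → q ≠ a →
      ∀ w ∈ Λ'', ∀ y ∈ Λ'', hexGraph.Adj w y → (hexDomainGraph Ω δ).Adj w y := by
  intro Ω δ Λ'' a b q π hΩΛ hseg hconn hq hqπ hqa
  exact hexDomainGraph_adj_of_geometry hΩΛ hseg hconn hq
    (mem_embMeshDomain_of_mem_support_of_ne π hqπ hqa)

end Summit.CriticalPhenomena.SAWScalingLimit.Theorems.ObservableToSLE.TypeLadder

end
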